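import Summits.QuantumFields.YangMills.Theorems.BalabanUVNodesN15NeumannCubeLiftDefect
import HarnessLib

/-!
# Route «BalabanUVNodes» (K3⁷), node N15 = NE2, -a lane, PROGRAMME P file P-IIe: ANY BIG-TORUS OPERATOR BEHIND THE UNCUT LIFTED CUBE PROPAGATOR — dag-n15-c WANT-n15-a (g12-2)(β′)
# (N-IIi `hasMaj_chiCube_comp_neumannCubeG` LIFTED to the torus of record for operators `T₁` that do NOT descend)

Cell `pub-ymgap`, seat `pub-ymgap-dag-n15-a` (KNIT-BY-NAME, g20; D-0062; chair R424 venue; `bears_on: R4∕N15`); `--kind proof --supports stmt-QuantumFields-20544 --as helper`.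
Sequel of P-IIa∕b∕c (`…NeumannCubeLift`, `…LiftRows`, `…LiftDefect`); answers dag-n15-c g12 I.30936 WANT-n15-a (g12-2)(β′): «for ANY torus operator `T₁` on `Tor (fine (L^K) M)` with
`T₁ ≤ a₁e^{−ρ₁|·|_T}` (M the BIG torus), `M_{χ_□} ∘ T₁ ∘ liftCubeG ≤ 1_□1_□·(κa₁)·e^{−ρd}`, `κ` uniform in `m_T`» (their `T₁ := [aQ*Q − ∂Π∂*, M_{h_k}]`, whose letter is `O(w⁻¹)`).

WHAT.  Torus pair `π : Tor M → Tor M′` (`M′_ν ∣ M_ν`), cube `□ + c` of side `S`, `M′_ν = 2S` (the doubled cube), `G^{↑}(□) = liftCubeG = π^* ∘ G(□′) ∘ (restriction to the cube's bonds)`.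
§28 ★ `circAbs_le_of_dvd` (`m′ ∣ m ⟹ dist(x, m′ℤ) ≤ dist(x, mℤ)`), ★ `tdistT_torRed_le` — THE REDUCTION IS 1-LIPSCHITZ: `|πy − πz|′ ≤ |y − z|`.
§29 ★★ `hasMaj_pull_restrict_of_blockMap` (master lemma, any two geometries: pull-back ∘ small operator ∘ windowed restriction has the small letter READ THROUGH the block map,
source-localized at the window — the UNCUT companion of P-IIa `hasMaj_transplant_of_blockMap`), ★★ `hasMaj_liftOp_of`, ★★ `hasMaj_liftCubeG_images` (the uncut lift's letter on the
big torus: `G^{↑}(□) ≤ 1_□(y′)·Ce^{δ₀}·Σ_T e^{−δ₀|refl′_T(πy) − πy′|′}` — programme N's images kernel read through `π`, for EVERY output block `y` of the big torus: the `2^{d+1}` images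
repeated with the period of the small torus).
§30 ★ `conv_exp_torRed_le` (the MIXED convolution: `Σ_z e^{−ρ₁|y−z|}e^{−δ₀|πz − w|′} ≤ c_r·e^{−ρ|πy − w|′}` for `ρ ≤ δ₀`, `ρ + σ ≤ ρ₁`, `c_r` the BIG torus's row sum at rate `σ` — the row
sum of `T₁` eats the periodic repetitions, the mixed triangle inequality `|πy − w|′ ≤ |y − z| + |πz − w|′` moves the decay; NO periodic-tail clause), ★★★ `hasMaj_comp_liftCubeG_images`
(`T₁ ∘ G^{↑}(□) ≤ 1_□(y′)·a₁Ce^{δ₀}c_r·Σ_T e^{−ρ|πy − refl′_T πy′|′}`, any target norm), ★★★ `hasMaj_chiCube_comp_liftCubeG_of` — (β′): `M_{χ_□} ∘ T₁ ∘ G^{↑}(□) ≤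
1_□(y)1_□(y′)·2^{d+1}a₁Ce^{δ₀}c_r·e^{−ρ|y−y′|_T}` (behind the cut the images are farther on the small torus and `|πy − πy′|′ = |y − y′|` on the cube) — the SAME constant as N-IIi's
one-torus row; ★★★ `hasMaj_chiCube_comp_liftCubeG_family` — on the torus family of record `M_ν = 2L^{m_T}`, cube torus `2L^s`, `s ≤ m_T`, spacing `L^K`, `K ≥ 1`, any corner, with
programme N's `δ₀, C` (part 39 `hasMaj_gOp` at the cube torus): constants UNIFORM in the volume `m_T`; the consumer supplies only `T₁`'s letter and the big torus's row sum.
HONEST FRAMING.  Block-majorant bookkeeping (restriction ∕ pull-back along `ZMod.castHom`, method of images, one row-sum convolution, a triangle inequality across the reduction); no new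
analytic estimate; `U ≡ 1` torus MODEL of [B5] §1; [B6]'s printed road for `G(□)` is the random-walk expansion (2.91)–(2.93) on `T_□` — here only the kinematics of `T_□ → T` is used;
nothing of [B6] (2.38)–(2.40) ∕ [B9] Thm 3.14 asserted; N15 NOT discharged (object-bound; NE2⁺ NOT PRINTED); counts UNMOVED (typed 28∕28 · discharged 5∕27); finite tori per index —
NOT continuum ∕ ℝ⁴ ∕ OS ∕ mass gap ∕ Clay.  Theorems only (0 def).
-/

noncomputable section

open scoped BigOperators Matrix
open Finset

namespace Summit.QuantumFields.YangMills.BalabanUVNodes.N15.TwoGrid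

open Literature.MathematicalPhysics.QuantumFieldTheory.Balaban1983to89
open Literature.MathematicalPhysics.QuantumFieldTheory.Balaban1983to89.B5Prop11Plancherel (Tor fine unitVec)
open Literature.MathematicalPhysics.QuantumFieldTheory.Balaban1983to89.B5Block118 (tstep up upHom iota bpt)
open Literature.MathematicalPhysics.QuantumFieldTheory.Balaban1983to89.B5SiteBridgeP12 (MP)
open Literature.MathematicalPhysics.QuantumFieldTheory.Balaban1983to89.B6Prop26Gluing (mulOp mulOp_apply ind ind_nonneg ind_le_one)
open Literature.MathematicalPhysics.QuantumFieldTheory.Balaban1983to89.B6Prop26ReachTransplant (restrictOp restrictOp_apply restrictOp_apply_of_injOn)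
open Literature.MathematicalPhysics.QuantumFieldTheory.King1986.Torus (blockOf tdistT tdistT_symm tdistT_triangle tdistT_nonneg toSite)
open Literature.MathematicalPhysics.QuantumFieldTheory.Balaban1983to89.B11SectG (BlockNorm HasMaj RowSum hasMaj_comp)
open Literature.MathematicalPhysics.QuantumFieldTheory.Balaban1983to89.B11AxialTransport190 (abs_le_loc_ofBlocks loc_ofBlocks_le)
open Literature.MathematicalPhysics.QuantumFieldTheory.Balaban1983to89.B6RandomWalk (Triangle254)
open Literature.MathematicalPhysics.QuantumFieldTheory.Balaban1983to89.B6UnitTorusCarrier (unitTorusGeo)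
open Literature.MathematicalPhysics.QuantumFieldTheory.Balaban1983to89.B4TorusKernel.MultiPeriod (circAbs circAbs_add_mul circAbs_le_abs emod_nonneg_of_one_le emod_lt_of_one_le)
open Literature.MathematicalPhysics.QuantumFieldTheory.Balaban1983to89.B4Sect5Torus (ccoord tdist)
open Summit.QuantumFields.YangMills.BalabanUVNodes.N15.VectorPiece (blkFine)

variable {d : ℕ}

/-! ## §28 The reduction `π : Tor M → Tor M′` is 1-Lipschitz for the torus distances -/

section Lipschitz

/-- ★ `m′ ∣ m ⟹ dist(x, m′ℤ) ≤ dist(x, mℤ)`: a coarser period can only bring lattice points closer. [folklore] -/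
theorem circAbs_le_of_dvd {m m' : ℕ} (h : m' ∣ m) (hm' : 1 ≤ m') (hm : 1 ≤ m) (x : ℤ) : circAbs m' x ≤ circAbs m x := by
  obtain ⟨q, hq⟩ := h
  have hr0 := emod_nonneg_of_one_le hm x
  have hr1 := emod_lt_of_one_le hm x
  have hdiv : (m : ℤ) * (x / (m : ℤ)) + x % (m : ℤ) = x := Int.mul_ediv_add_emod x (m : ℤ)
  have hmq : (m : ℤ) = (m' : ℤ) * (q : ℤ) := by exact_mod_cast hq
  have e1 : circAbs m' x = circAbs m' (x % (m : ℤ)) := by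
    have h3 : (m : ℤ) * (x / (m : ℤ)) = (m' : ℤ) * ((q : ℤ) * (x / (m : ℤ))) := by rw [hmq]; ring
    have hx : x = x % (m : ℤ) + (m' : ℤ) * ((q : ℤ) * (x / (m : ℤ))) := by linarith [hdiv, h3]
    conv_lhs => rw [hx]
    rw [circAbs_add_mul]
  have h1 : circAbs m' (x % (m : ℤ)) ≤ x % (m : ℤ) := (circAbs_le_abs hm' _).trans (le_of_eq (abs_of_nonneg hr0))
  have h2 : circAbs m' (x % (m : ℤ)) ≤ (m : ℤ) - x % (m : ℤ) := by
    have e2 : circAbs m' (x % (m : ℤ)) = circAbs m' (x % (m : ℤ) - m) := by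
      have hx : x % (m : ℤ) = (x % (m : ℤ) - m) + (m' : ℤ) * (q : ℤ) := by rw [hmq]; ring
      conv_lhs => rw [hx]
      rw [circAbs_add_mul]
    rw [e2]
    refine (circAbs_le_abs hm' _).trans (le_of_eq ?_)
    rw [abs_of_nonpos (by linarith)]
    ring
  calc circAbs m' x = circAbs m' (x % (m : ℤ)) := e1
    _ ≤ min (x % (m : ℤ)) ((m : ℤ) - x % (m : ℤ)) := le_min h1 h2
    _ = circAbs m x := rfl

variable {N N' : Fin (d + 1) → ℕ} [∀ μ, NeZero (N μ)] [∀ μ, NeZero (N' μ)] (hN : ∀ μ, N' μ ∣ N μ)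

/-- ★ **THE REDUCTION IS 1-LIPSCHITZ**: `|πy − πz|_{T′} ≤ |y − z|_T` (coordinatewise `dist(a − b, N′ℤ) ≤ dist(a − b, Nℤ)` for `N′ ∣ N`). [folklore] -/
theorem tdistT_torRed_le (y z : Tor N) : tdistT N' (torRed hN y) (torRed hN z) ≤ tdistT N y z := by
  unfold tdistT tdist
  refine Nat.cast_le.mpr (Finset.sup_mono_fun fun ν _ => ?_)
  rw [ccoord_toSite, ccoord_toSite]
  have hN1 : 1 ≤ N ν := Nat.pos_of_ne_zero (NeZero.ne _)
  have hN1' : 1 ≤ N' ν := Nat.pos_of_ne_zero (NeZero.ne _)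
  refine Int.toNat_le_toNat ?_
  -- the reduced coordinates are the residues; their difference is the original difference up to a multiple of `N′_ν`
  have e : ((torRed hN y ν).val : ℤ) - (torRed hN z ν).val =
      (((y ν).val : ℤ) - (z ν).val) + (N' ν : ℤ) * (((z ν).val : ℤ) / (N' ν : ℤ) - ((y ν).val : ℤ) / (N' ν : ℤ)) := by
    rw [val_torRed_eq_mod hN y ν, val_torRed_eq_mod hN z ν]
    push_cast
    have h1 := Int.mul_ediv_add_emod (((y ν).val : ℤ)) (N' ν : ℤ)
    have h2 := Int.mul_ediv_add_emod (((z ν).val : ℤ)) (N' ν : ℤ)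
    linear_combination h1 - h2
  rw [e, circAbs_add_mul]
  exact circAbs_le_of_dvd (hN ν) hN1' hN1 _

end Lipschitz

/-! ## §29 The UNCUT lift's letter: the small operator's letter read through the block map, source-localized at the window -/

section LiftLetter

/-- ★★ **MASTER LEMMA (uncut lift)**: for a window `W ⊆ X` mapped injectively by `e` into `X′`, blocks compatible EVERYWHERE (`blk′(e x) = σ(blk x)`) and a pull-back `Pl f = f ∘ e`, an operator
`T′` of the small lattice with block letter `K′ ≥ 0` lifts to `Pl ∘ T′ ∘ restrict_W` with letter `1_B(y′)·K′(σy, σy′)` whenever the window's blocks lie in `B` — for EVERY output block `y`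
(no output cut: the companion of P-IIa `hasMaj_transplant_of_blockMap`). [cite: Balaban1984PropagatorsII, (2.90)–(2.91) p.239 (operators of `T_□` read on the big lattice)] -/
theorem hasMaj_pull_restrict_of_blockMap {X X' : Type} [Fintype X] [Fintype X'] [DecidableEq X] [DecidableEq X'] {g g' : B6.Geometry} (blk : X → g.Site)
    (blk' : X' → g'.Site) (σ : g.Site → g'.Site) (W : Finset X) (e : X → X') (B : Set g.Site) (hblk : ∀ x, blk' (e x) = σ (blk x))
    (hWB : ∀ x ∈ W, blk x ∈ B) (hinj : Set.InjOn e ↑W) {Pl : (X' → ℝ) →ₗ[ℝ] (X → ℝ)} (hPl : ∀ f x, Pl f x = f (e x)) {T' : Module.End ℝ (X' → ℝ)}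
    {K' : g'.Site → g'.Site → ℝ} (hK' : ∀ a b, 0 ≤ K' a b) (hT : HasMaj (BlockNorm.ofBlocks g' blk') (BlockNorm.ofBlocks g' blk') T' K') :
    HasMaj (BlockNorm.ofBlocks g blk) (BlockNorm.ofBlocks g blk) (Pl ∘ₗ T' ∘ₗ restrictOp W e) (fun y y' => ind B y' * K' (σ y) (σ y')) := by
  classical
  intro y' μ hμ y
  dsimp only
  have hμ' : ∀ x, blk x ≠ y' → μ x = 0 := hμ
  have hloc0 : 0 ≤ (BlockNorm.ofBlocks g blk).loc y' μ := (BlockNorm.ofBlocks g blk).loc_nonneg y' μ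
  by_cases hy' : y' ∈ B
  swap
  · -- the window misses the block of `y′`: the restriction vanishes
    have hρ : restrictOp W e μ = 0 := by
      funext x'
      rw [restrictOp_apply, Pi.zero_apply]
      refine Finset.sum_eq_zero fun x hx => ?_
      rw [Finset.mem_filter] at hx
      exact hμ' x fun hb => hy' (hb ▸ hWB x hx.1)
    have h0 : (Pl ∘ₗ T' ∘ₗ restrictOp W e) μ = 0 := by rw [LinearMap.comp_apply, LinearMap.comp_apply, hρ, map_zero, map_zero]
    rw [h0, (BlockNorm.ofBlocks g blk).loc_zero]
    exact mul_nonneg (mul_nonneg (ind_nonneg _ _) (hK' _ _)) hloc0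
  -- the restriction is localized at `σ y′` and no larger than `μ`
  have hloc'μ : (BlockNorm.ofBlocks g' blk').IsLoc (σ y') (restrictOp W e μ) := by
    intro x' hx'
    rw [restrictOp_apply]
    refine Finset.sum_eq_zero fun x hx => ?_
    rw [Finset.mem_filter] at hx
    by_contra hne
    have hb : blk x = y' := by by_contra hb; exact hne (hμ' x hb)
    exact hx' (by rw [← hx.2, hblk x, hb])
  have hle : (BlockNorm.ofBlocks g' blk').loc (σ y') (restrictOp W e μ) ≤ (BlockNorm.ofBlocks g blk).loc y' μ := by
    refine loc_ofBlocks_le blk' _ hloc0 fun x' _ => ?_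
    by_cases hex : ∃ x ∈ W, e x = x' ∧ μ x ≠ 0
    · obtain ⟨x, hxW, hxe, hxμ⟩ := hex
      have hb : blk x = y' := by by_contra hb; exact hxμ (hμ' x hb)
      rw [← hxe, restrictOp_apply_of_injOn hinj μ hxW]
      exact abs_le_loc_ofBlocks blk μ hb
    · have h0 : restrictOp W e μ x' = 0 := by
        rw [restrictOp_apply]
        refine Finset.sum_eq_zero fun x hx => ?_
        rw [Finset.mem_filter] at hx
        by_contra hne
        exact hex ⟨x, hx.1, hx.2, hne⟩
      rw [h0, abs_zero]; exact (BlockNorm.ofBlocks g blk).loc_nonneg y' μ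
  have h1 := hT (σ y') (restrictOp W e μ) hloc'μ (σ y)
  -- the output, read on the big lattice through the pull-back (NO cut: every block `y` is controlled by the small block `σ y`)
  have hout : (BlockNorm.ofBlocks g blk).loc y ((Pl ∘ₗ T' ∘ₗ restrictOp W e) μ) ≤ (BlockNorm.ofBlocks g' blk').loc (σ y) (T' (restrictOp W e μ)) := by
    refine loc_ofBlocks_le blk _ ((BlockNorm.ofBlocks g' blk').loc_nonneg _ _) fun x hx => ?_
    rw [LinearMap.comp_apply, LinearMap.comp_apply, hPl]
    exact abs_le_loc_ofBlocks blk' _ (by rw [hblk x, hx])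
  rw [show ind B y' = 1 from by unfold ind; rw [if_pos hy'], one_mul]
  exact hout.trans (h1.trans (mul_le_mul_of_nonneg_left hle (hK' _ _)))

variable {L : ℕ} (n : ℕ) [NeZero n] {M M' : Fin (d + 1) → ℕ} [∀ μ, NeZero (M μ)] [∀ μ, NeZero (M' μ)] (hM : ∀ μ, M' μ ∣ M μ) (c : Tor M) (S : ℕ) {k : ℕ}

/-- ★★ **THE UNCUT LIFT OF A SMALL-TORUS OPERATOR HAS ITS LETTER READ THROUGH `π`**: if `X′ ≤ K′` on the cube torus (`S ≤ M′_ν`), then on the big torus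
`X′^{↑} = π^* ∘ X′ ∘ restrict_□ ≤ 1_□(y′)·K′(πy, πy′)` for EVERY output block `y`. [cite: Balaban1984PropagatorsII, (2.90)–(2.91) p.239] -/
theorem hasMaj_liftOp_of (hS : ∀ ν, S ≤ M' ν) {X' : Module.End ℝ (Tor (fine n M') × Fin (d + 1) → ℝ)} {K' : Tor M' → Tor M' → ℝ} (hK' : ∀ a b, 0 ≤ K' a b)
    (hX : HasMaj (BlockNorm.ofBlocks (unitTorusGeo L k M') (fun b : Tor (fine n M') × Fin (d + 1) => blockOf n M' b.1))
      (BlockNorm.ofBlocks (unitTorusGeo L k M') (fun b : Tor (fine n M') × Fin (d + 1) => blockOf n M' b.1)) X' K') :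
    HasMaj (BlockNorm.ofBlocks (unitTorusGeo L k M) (fun b : Tor (fine n M) × Fin (d + 1) => blockOf n M b.1))
      (BlockNorm.ofBlocks (unitTorusGeo L k M) (fun b : Tor (fine n M) × Fin (d + 1) => blockOf n M b.1)) (liftOp n hM c S X')
      (fun y y' => ind (cubeBlocks M c S : Set (Tor M)) y' * K' (torRed hM y) (torRed hM y')) :=
  hasMaj_pull_restrict_of_blockMap (g := unitTorusGeo L k M) (g' := unitTorusGeo L k M') (fun b : Tor (fine n M) × Fin (d + 1) => blockOf n M b.1)
    (fun b : Tor (fine n M') × Fin (d + 1) => blockOf n M' b.1) (torRed hM) (cubeW n c S) (redBond n hM) (cubeBlocks M c S : Set (Tor M))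
    (fun x => kingBlockOf_torRed (hM := hM) x.1) (fun x hx => (mem_cubeW x).1 hx) (redBond_injOn_cubeW hS) (Pl := pullVR n hM)
    (fun f x => by obtain ⟨x, μ⟩ := x; rw [pullVR_apply]; rfl) hK' hX

/-- ★★ **THE UNCUT LIFTED CUBE PROPAGATOR'S LETTER ON THE BIG TORUS — THE IMAGES KERNEL READ THROUGH `π`** (`M′_ν = 2S`): from the cube torus's letter `G′ ≤ Ce^{−δ₀d′}`,
`G^{↑}(□ + c) ≤ 1_□(y′)·Ce^{δ₀}·Σ_T e^{−δ₀|refl′_T(πy) − πy′|′}` for EVERY output block `y` of the big torus: the `2^{d+1}` mirror images, repeated with the period of the cube torus.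
[cite: Balaban1984PropagatorsII, (2.37) p.229 (images), (2.90)–(2.91) p.239; Balaban1984PropagatorsI, Prop. 1.2 (1.110) p.35] -/
theorem hasMaj_liftCubeG_images (hM2 : ∀ ν, M' ν = 2 * S) {a C δ₀ : ℝ} (hC : 0 ≤ C) (hδ₀ : 0 ≤ δ₀)
    (hG' : HasMaj (BlockNorm.ofBlocks (unitTorusGeo L k M') (fun b : Tor (fine n M') × Fin (d + 1) => blockOf n M' b.1))
      (BlockNorm.ofBlocks (unitTorusGeo L k M') (fun b : Tor (fine n M') × Fin (d + 1) => blockOf n M' b.1)) (gOp M' n a) (fun y y' => C * Real.exp (-(δ₀ * tdistT M' y y')))) :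
    HasMaj (BlockNorm.ofBlocks (unitTorusGeo L k M) (fun b : Tor (fine n M) × Fin (d + 1) => blockOf n M b.1))
      (BlockNorm.ofBlocks (unitTorusGeo L k M) (fun b : Tor (fine n M) × Fin (d + 1) => blockOf n M b.1)) (liftCubeG n hM c S a)
      (fun y y' => ind (cubeBlocks M c S : Set (Tor M)) y' * (C * Real.exp δ₀ *
        ∑ T ∈ (Finset.univ : Finset (Fin (d + 1))).powerset, Real.exp (-(δ₀ * tdistT M' (reflBlk M' (torRed hM c) T (torRed hM y)) (torRed hM y'))))) := by
  have hS : ∀ ν, S ≤ M' ν := fun ν => by rw [hM2 ν]; omega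
  have hN' := hasMaj_neumannCubeG_images_of (c := torRed hM c) (S := S) hC hδ₀ hG'
  have hK' : ∀ z z' : Tor M', 0 ≤ ind (g := unitTorusGeo L k M') (cubeBlocks M' (torRed hM c) S : Set (Tor M')) z' *
      (C * Real.exp δ₀ * ∑ T ∈ (Finset.univ : Finset (Fin (d + 1))).powerset, Real.exp (-(δ₀ * tdistT M' (reflBlk M' (torRed hM c) T z) z'))) :=
    fun z z' => mul_nonneg (ind_nonneg _ _) (mul_nonneg (by positivity) (Finset.sum_nonneg fun _ _ => Real.exp_nonneg _))
  rw [liftCubeG_eq_liftOp]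
  refine (hasMaj_liftOp_of n hM c S hS hK' hN').mono fun y y' => ?_
  have hsum0 : 0 ≤ C * Real.exp δ₀ * ∑ T ∈ (Finset.univ : Finset (Fin (d + 1))).powerset,
      Real.exp (-(δ₀ * tdistT M' (reflBlk M' (torRed hM c) T (torRed hM y)) (torRed hM y'))) :=
    mul_nonneg (by positivity) (Finset.sum_nonneg fun _ _ => Real.exp_nonneg _)
  calc ind (cubeBlocks M c S : Set (Tor M)) y' * (ind (g := unitTorusGeo L k M') (cubeBlocks M' (torRed hM c) S : Set (Tor M')) (torRed hM y') * (C * Real.exp δ₀ *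
        ∑ T ∈ (Finset.univ : Finset (Fin (d + 1))).powerset, Real.exp (-(δ₀ * tdistT M' (reflBlk M' (torRed hM c) T (torRed hM y)) (torRed hM y')))))
      ≤ ind (cubeBlocks M c S : Set (Tor M)) y' * (1 * (C * Real.exp δ₀ *
        ∑ T ∈ (Finset.univ : Finset (Fin (d + 1))).powerset, Real.exp (-(δ₀ * tdistT M' (reflBlk M' (torRed hM c) T (torRed hM y)) (torRed hM y'))))) :=
        mul_le_mul_of_nonneg_left (mul_le_mul_of_nonneg_right (ind_le_one _ _) hsum0) (ind_nonneg _ _)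
    _ = _ := by rw [one_mul]

end LiftLetter

/-! ## §30 ANY big-torus operator behind the uncut lift: the mixed convolution; behind the cut the images are farther; the family of record -/

section Row

variable {L : ℕ} (n : ℕ) [NeZero n] {M M' : Fin (d + 1) → ℕ} [∀ μ, NeZero (M μ)] [∀ μ, NeZero (M' μ)] (hM : ∀ μ, M' μ ∣ M μ) (c : Tor M) (S : ℕ) {k : ℕ}

/-- ★ **THE MIXED CONVOLUTION**: `Σ_z e^{−ρ₁|y − z|_T}·e^{−δ₀|πz − w|′} ≤ c_r·e^{−ρ|πy − w|′}` for `ρ ≤ δ₀`, `ρ + σ ≤ ρ₁`, `c_r` the BIG torus's row sum at rate `σ`: the row sum eats the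
periodic repetitions, the mixed triangle inequality `|πy − w|′ ≤ |πy − πz|′ + |πz − w|′ ≤ |y − z| + |πz − w|′` moves the decay. [cite: Balaban1984PropagatorsII, Lemma 2.1 (2.61)–(2.62) p.234] -/
theorem conv_exp_torRed_le {ρ₁ δ₀ ρ σ cr : ℝ} (htri' : Triangle254 (unitTorusGeo L k M')) (hrow : RowSum (unitTorusGeo L k M) σ cr) (hρ : 0 ≤ ρ) (hρδ : ρ ≤ δ₀) (hρσ : ρ + σ ≤ ρ₁)
    (y : Tor M) (w : Tor M') :
    ∑ z : Tor M, Real.exp (-(ρ₁ * tdistT M y z)) * Real.exp (-(δ₀ * tdistT M' (torRed hM z) w)) ≤ cr * Real.exp (-(ρ * tdistT M' (torRed hM y) w)) := by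
  have hterm : ∀ z : Tor M, Real.exp (-(ρ₁ * tdistT M y z)) * Real.exp (-(δ₀ * tdistT M' (torRed hM z) w)) ≤
      Real.exp (-(σ * tdistT M y z)) * Real.exp (-(ρ * tdistT M' (torRed hM y) w)) := by
    intro z
    rw [← Real.exp_add, ← Real.exp_add]
    refine Real.exp_le_exp.mpr ?_
    have hd := tdistT_nonneg M y z
    have hD := tdistT_nonneg M' (torRed hM z) w
    have htri : tdistT M' (torRed hM y) w ≤ tdistT M' (torRed hM y) (torRed hM z) + tdistT M' (torRed hM z) w := htri' _ _ _
    have hlip := tdistT_torRed_le hM y z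
    have h1 : ρ * tdistT M' (torRed hM y) w ≤ ρ * tdistT M y z + ρ * tdistT M' (torRed hM z) w := by
      have := mul_le_mul_of_nonneg_left (htri.trans (add_le_add hlip le_rfl)) hρ
      rw [mul_add] at this
      exact this
    nlinarith [mul_le_mul_of_nonneg_right hρδ hD, mul_le_mul_of_nonneg_right hρσ hd]
  calc ∑ z : Tor M, Real.exp (-(ρ₁ * tdistT M y z)) * Real.exp (-(δ₀ * tdistT M' (torRed hM z) w))
      ≤ ∑ z : Tor M, Real.exp (-(σ * tdistT M y z)) * Real.exp (-(ρ * tdistT M' (torRed hM y) w)) := Finset.sum_le_sum fun z _ => hterm z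
    _ = (∑ z : Tor M, Real.exp (-(σ * tdistT M y z))) * Real.exp (-(ρ * tdistT M' (torRed hM y) w)) := by rw [Finset.sum_mul]
    _ ≤ cr * Real.exp (-(ρ * tdistT M' (torRed hM y) w)) := mul_le_mul_of_nonneg_right (hrow y) (Real.exp_nonneg _)

/-- ★★★ **ANY BIG-TORUS OPERATOR BEHIND THE UNCUT LIFTED CUBE PROPAGATOR** (`M′_ν = 2S`, any target norm): if `T₁ ≤ a₁e^{−ρ₁|·|_T}` on the big torus (it need NOT descend) and
`G′ ≤ Ce^{−δ₀d′}` on the cube torus, then `T₁ ∘ G^{↑}(□ + c) ≤ 1_□(y′)·a₁Ce^{δ₀}c_r·Σ_T e^{−ρ|πy − refl′_T(πy′)|′}` (`c_r` the big torus's row sum at `σ`, `ρ ≤ δ₀`, `ρ + σ ≤ ρ₁`).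
[cite: Balaban1984PropagatorsII, (2.37) p.229 (images), Lemma 2.1 (2.61)–(2.62) p.234, (2.90)–(2.91) p.239; Balaban1984PropagatorsI, (1.126)–(1.128) p.38] -/
theorem hasMaj_comp_liftCubeG_images (hM2 : ∀ ν, M' ν = 2 * S) {F₃ : Type} [AddCommGroup F₃] [Module ℝ F₃] {b₃ : BlockNorm (unitTorusGeo L k M) F₃}
    {T₁ : (Tor (fine n M) × Fin (d + 1) → ℝ) →ₗ[ℝ] F₃} {a C a₁ δ₀ ρ₁ ρ σ cr : ℝ} (htri' : Triangle254 (unitTorusGeo L k M')) (hrow : RowSum (unitTorusGeo L k M) σ cr)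
    (hC : 0 ≤ C) (hδ₀ : 0 ≤ δ₀) (ha₁ : 0 ≤ a₁) (hρ : 0 ≤ ρ) (hρδ : ρ ≤ δ₀) (hρσ : ρ + σ ≤ ρ₁)
    (h₁ : HasMaj (BlockNorm.ofBlocks (unitTorusGeo L k M) (fun b : Tor (fine n M) × Fin (d + 1) => blockOf n M b.1)) b₃ T₁ (fun y y' => a₁ * Real.exp (-(ρ₁ * tdistT M y y'))))
    (hG' : HasMaj (BlockNorm.ofBlocks (unitTorusGeo L k M') (fun b : Tor (fine n M') × Fin (d + 1) => blockOf n M' b.1))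
      (BlockNorm.ofBlocks (unitTorusGeo L k M') (fun b : Tor (fine n M') × Fin (d + 1) => blockOf n M' b.1)) (gOp M' n a) (fun y y' => C * Real.exp (-(δ₀ * tdistT M' y y')))) :
    HasMaj (BlockNorm.ofBlocks (unitTorusGeo L k M) (fun b : Tor (fine n M) × Fin (d + 1) => blockOf n M b.1)) b₃ (T₁ ∘ₗ liftCubeG n hM c S a)
      (fun y y' => ind (cubeBlocks M c S : Set (Tor M)) y' * (a₁ * (C * Real.exp δ₀) * cr *
        ∑ T ∈ (Finset.univ : Finset (Fin (d + 1))).powerset, Real.exp (-(ρ * tdistT M' (torRed hM y) (reflBlk M' (torRed hM c) T (torRed hM y')))))) := by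
  have hcr : 0 ≤ cr := hrow.nonneg c
  have hL := hasMaj_liftCubeG_images n hM c S hM2 hC hδ₀ hG'
  refine (hasMaj_comp h₁ hL fun y y' => mul_nonneg ha₁ (Real.exp_nonneg _)).mono fun y y' => ?_
  dsimp only
  have hκ : (BlockNorm.ofBlocks (unitTorusGeo L k M) (fun b : Tor (fine n M) × Fin (d + 1) => blockOf n M b.1)).κ = 1 := rfl
  rw [hκ]
  -- move the images to the far argument, swap the sums, convolve image by image
  have hper : ∀ T : Finset (Fin (d + 1)), ∑ z : Tor M, Real.exp (-(ρ₁ * tdistT M y z)) *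
      Real.exp (-(δ₀ * tdistT M' (reflBlk M' (torRed hM c) T (torRed hM z)) (torRed hM y'))) ≤
        cr * Real.exp (-(ρ * tdistT M' (torRed hM y) (reflBlk M' (torRed hM c) T (torRed hM y')))) := by
    intro T
    have h := conv_exp_torRed_le hM htri' hrow hρ hρδ hρσ y (reflBlk M' (torRed hM c) T (torRed hM y'))
    refine le_trans (le_of_eq (Finset.sum_congr rfl fun z _ => ?_)) h
    rw [tdistT_reflBlk_comm]
  calc ∑ z : Tor M, a₁ * Real.exp (-(ρ₁ * tdistT M y z)) * (1 * (ind (cubeBlocks M c S : Set (Tor M)) y' * (C * Real.exp δ₀ *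
          ∑ T ∈ (Finset.univ : Finset (Fin (d + 1))).powerset, Real.exp (-(δ₀ * tdistT M' (reflBlk M' (torRed hM c) T (torRed hM z)) (torRed hM y'))))))
      = ∑ z : Tor M, ∑ T ∈ (Finset.univ : Finset (Fin (d + 1))).powerset, ind (cubeBlocks M c S : Set (Tor M)) y' * (a₁ * (C * Real.exp δ₀)) *
          (Real.exp (-(ρ₁ * tdistT M y z)) * Real.exp (-(δ₀ * tdistT M' (reflBlk M' (torRed hM c) T (torRed hM z)) (torRed hM y')))) := by
        refine Finset.sum_congr rfl fun z _ => ?_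
        simp only [Finset.mul_sum]
        exact Finset.sum_congr rfl fun T _ => by ring
    _ = ind (cubeBlocks M c S : Set (Tor M)) y' * (a₁ * (C * Real.exp δ₀)) * ∑ T ∈ (Finset.univ : Finset (Fin (d + 1))).powerset,
          ∑ z : Tor M, Real.exp (-(ρ₁ * tdistT M y z)) * Real.exp (-(δ₀ * tdistT M' (reflBlk M' (torRed hM c) T (torRed hM z)) (torRed hM y'))) := by
        rw [Finset.sum_comm, Finset.mul_sum]
        exact Finset.sum_congr rfl fun T _ => by rw [Finset.mul_sum]
    _ ≤ ind (cubeBlocks M c S : Set (Tor M)) y' * (a₁ * (C * Real.exp δ₀)) * ∑ T ∈ (Finset.univ : Finset (Fin (d + 1))).powerset,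
          cr * Real.exp (-(ρ * tdistT M' (torRed hM y) (reflBlk M' (torRed hM c) T (torRed hM y')))) :=
        mul_le_mul_of_nonneg_left (Finset.sum_le_sum fun T _ => hper T) (mul_nonneg (ind_nonneg _ _) (by positivity))
    _ = _ := by rw [← Finset.mul_sum]; ring

/-- ★★★ **(β′) — N-IIi LIFTED: ANY BIG-TORUS OPERATOR BEHIND THE LIFTED CUBE PROPAGATOR, OUTPUT-CUT** (`M′_ν = 2S ∣ M_ν`): if `T₁ ≤ a₁e^{−ρ₁|·|_T}` on the big torus and `G′ ≤ Ce^{−δ₀d′}`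
on the cube torus, then `M_{χ_□} ∘ T₁ ∘ G^{↑}(□ + c) ≤ 1_□(y)1_□(y′)·2^{d+1}a₁Ce^{δ₀}c_r·e^{−ρ|y − y′|_T}` — behind the cut the mirror images are farther on the cube torus and
`|πy − πy′|′ = |y − y′|_T` on the cube; the SAME constant as the one-torus row. [cite: Balaban1984PropagatorsII, (2.37) p.229, Lemma 2.1 (2.61)–(2.62) p.234, (2.133)–(2.134) p.247] -/
theorem hasMaj_chiCube_comp_liftCubeG_of (hM2 : ∀ ν, M' ν = 2 * S) {T₁ : Module.End ℝ (Tor (fine n M) × Fin (d + 1) → ℝ)} {a C a₁ δ₀ ρ₁ ρ σ cr : ℝ}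
    (htri' : Triangle254 (unitTorusGeo L k M')) (hrow : RowSum (unitTorusGeo L k M) σ cr) (hC : 0 ≤ C) (hδ₀ : 0 ≤ δ₀) (ha₁ : 0 ≤ a₁) (hρ : 0 ≤ ρ) (hρδ : ρ ≤ δ₀)
    (hρσ : ρ + σ ≤ ρ₁)
    (h₁ : HasMaj (BlockNorm.ofBlocks (unitTorusGeo L k M) (fun b : Tor (fine n M) × Fin (d + 1) => blockOf n M b.1))
      (BlockNorm.ofBlocks (unitTorusGeo L k M) (fun b : Tor (fine n M) × Fin (d + 1) => blockOf n M b.1)) T₁ (fun y y' => a₁ * Real.exp (-(ρ₁ * tdistT M y y'))))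
    (hG' : HasMaj (BlockNorm.ofBlocks (unitTorusGeo L k M') (fun b : Tor (fine n M') × Fin (d + 1) => blockOf n M' b.1))
      (BlockNorm.ofBlocks (unitTorusGeo L k M') (fun b : Tor (fine n M') × Fin (d + 1) => blockOf n M' b.1)) (gOp M' n a) (fun y y' => C * Real.exp (-(δ₀ * tdistT M' y y')))) :
    HasMaj (BlockNorm.ofBlocks (unitTorusGeo L k M) (fun b : Tor (fine n M) × Fin (d + 1) => blockOf n M b.1))
      (BlockNorm.ofBlocks (unitTorusGeo L k M) (fun b : Tor (fine n M) × Fin (d + 1) => blockOf n M b.1)) (mulOp (chiCube M n c S) ∘ₗ T₁ ∘ₗ liftCubeG n hM c S a)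
      (fun y y' => ind (cubeBlocks M c S : Set (Tor M)) y * ind (cubeBlocks M c S : Set (Tor M)) y' *
        (2 ^ (d + 1) * (a₁ * (C * Real.exp δ₀) * cr) * Real.exp (-(ρ * tdistT M y y')))) := by
  have hcr : 0 ≤ cr := hrow.nonneg c
  have hS2' : ∀ ν, 2 * S ≤ M' ν := fun ν => (hM2 ν).ge
  have hS2 : ∀ ν, 2 * S ≤ M ν := fun ν => (hS2' ν).trans (Nat.le_of_dvd (Nat.pos_of_ne_zero (NeZero.ne _)) (hM ν))
  have hS : ∀ ν, S ≤ M' ν := fun ν => by rw [hM2 ν]; omega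
  have h := hasMaj_mulOp_chiCube_comp (c := c) (S := S) (fun y y' => mul_nonneg (ind_nonneg _ _) (mul_nonneg (by positivity)
    (Finset.sum_nonneg fun _ _ => Real.exp_nonneg _))) (hasMaj_comp_liftCubeG_images n hM c S hM2 htri' hrow hC hδ₀ ha₁ hρ hρδ hρσ h₁ hG')
  refine h.mono fun y y' => ?_
  by_cases hy : y ∈ cubeBlocks M c S
  · by_cases hy' : y' ∈ cubeBlocks M c S
    · have hi : ind (cubeBlocks M c S : Set (Tor M)) y = 1 := by simp [ind, hy]
      have hi' : ind (cubeBlocks M c S : Set (Tor M)) y' = 1 := by simp [ind, hy']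
      have hA0 : 0 ≤ a₁ * (C * Real.exp δ₀) * cr := by positivity
      have hπy := torRed_mem_cubeBlocks (hM := hM) hS hy
      have hπy' := torRed_mem_cubeBlocks (hM := hM) hS hy'
      have heq := tdistT_torRed_eq (hM := hM) hS2 hS2' hy hy'
      have hsumT : ∑ T ∈ (Finset.univ : Finset (Fin (d + 1))).powerset, Real.exp (-(ρ * tdistT M' (torRed hM y) (reflBlk M' (torRed hM c) T (torRed hM y')))) ≤
          2 ^ (d + 1) * Real.exp (-(ρ * tdistT M y y')) :=
        calc ∑ T ∈ (Finset.univ : Finset (Fin (d + 1))).powerset, Real.exp (-(ρ * tdistT M' (torRed hM y) (reflBlk M' (torRed hM c) T (torRed hM y'))))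
            ≤ ∑ T ∈ (Finset.univ : Finset (Fin (d + 1))).powerset, Real.exp (-(ρ * tdistT M y y')) :=
              Finset.sum_le_sum fun T _ => Real.exp_le_exp.mpr (by
                have := tdistT_le_tdistT_reflBlk (c := torRed hM c) hM2 hπy' hπy T
                rw [tdistT_symm M' (torRed hM y') (torRed hM y), heq, tdistT_symm M' (reflBlk M' (torRed hM c) T (torRed hM y')) (torRed hM y)] at this
                nlinarith)
          _ = 2 ^ (d + 1) * Real.exp (-(ρ * tdistT M y y')) := by
              rw [Finset.sum_const, Finset.card_powerset, Finset.card_univ, Fintype.card_fin, nsmul_eq_mul]; push_cast; ring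
      simp only [hi, hi', one_mul]
      calc a₁ * (C * Real.exp δ₀) * cr * ∑ T ∈ (Finset.univ : Finset (Fin (d + 1))).powerset,
            Real.exp (-(ρ * tdistT M' (torRed hM y) (reflBlk M' (torRed hM c) T (torRed hM y'))))
          ≤ a₁ * (C * Real.exp δ₀) * cr * (2 ^ (d + 1) * Real.exp (-(ρ * tdistT M y y'))) := mul_le_mul_of_nonneg_left hsumT hA0
        _ = 2 ^ (d + 1) * (a₁ * (C * Real.exp δ₀) * cr) * Real.exp (-(ρ * tdistT M y y')) := by ring
    · have hi' : ind (cubeBlocks M c S : Set (Tor M)) y' = 0 := by simp [ind, hy']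
      rw [hi']; simp
  · have hi : ind (cubeBlocks M c S : Set (Tor M)) y = 0 := by simp [ind, hy]
    rw [hi]; simp

variable [NeZero L]

/-- ★★★ **(β′) ON THE TORUS FAMILY OF RECORD**: for odd `L ≥ 3` and `a > 0` there are `δ₀, C > 0` (programme N's, at the cube torus) such that for all `s ≤ m_T`, `K ≥ 1`, any corner `c`
of `Tor (2L^{m_T})`, ANY operator `T₁ ≤ a₁e^{−ρ₁|·|_T}` of the big torus and any row sum `c_r` of the big torus at rate `σ` with `ρ ≤ δ₀`, `ρ + σ ≤ ρ₁`:
`M_{χ_□} ∘ T₁ ∘ G^{↑}(□ + c) ≤ 1_□(y)1_□(y′)·2^{d+1}a₁Ce^{δ₀}c_r·e^{−ρ|y−y′|_T}` — constants UNIFORM in the volume `m_T`.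
[cite: Balaban1984PropagatorsII, (2.37) p.229, Lemma 2.1 (2.61)–(2.62) p.234, p.238 (T_□), (2.133)–(2.134) p.247; Balaban1984PropagatorsI, Prop. 1.2 (1.110) p.35] -/
theorem hasMaj_chiCube_comp_liftCubeG_family (hL : Odd L ∧ 1 < L) {a : ℝ} (ha : 0 < a) :
    ∃ δ₀ C : ℝ, 0 < δ₀ ∧ 0 < C ∧ ∀ (s mT K : ℕ) (hs : s ≤ mT) (hK : 1 ≤ K) (c : Tor (MP (paramsOf d L mT K hL)))
      (T₁ : Module.End ℝ (Tor (fine (L ^ K) (MP (paramsOf d L mT K hL))) × Fin (d + 1) → ℝ)) {a₁ ρ₁ ρ σ cr : ℝ}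
      (hrow : RowSum (unitTorusGeo L K (MP (paramsOf d L mT K hL))) σ cr) (ha₁ : 0 ≤ a₁) (hρ : 0 ≤ ρ) (hρδ : ρ ≤ δ₀) (hρσ : ρ + σ ≤ ρ₁)
      (h₁ : HasMaj (BlockNorm.ofBlocks (unitTorusGeo L K (MP (paramsOf d L mT K hL))) (blkFine L K (MP (paramsOf d L mT K hL))))
        (BlockNorm.ofBlocks (unitTorusGeo L K (MP (paramsOf d L mT K hL))) (blkFine L K (MP (paramsOf d L mT K hL)))) T₁
        (fun y y' => a₁ * Real.exp (-(ρ₁ * tdistT (MP (paramsOf d L mT K hL)) y y')))),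
      HasMaj (BlockNorm.ofBlocks (unitTorusGeo L K (MP (paramsOf d L mT K hL))) (blkFine L K (MP (paramsOf d L mT K hL))))
        (BlockNorm.ofBlocks (unitTorusGeo L K (MP (paramsOf d L mT K hL))) (blkFine L K (MP (paramsOf d L mT K hL))))
        (mulOp (chiCube (MP (paramsOf d L mT K hL)) (L ^ K) c (L ^ s)) ∘ₗ T₁ ∘ₗ liftCubeG (L ^ K) (MP_dvd_MP hL hs K) c (L ^ s) a)
        (fun y y' => ind ((cubeBlocks (MP (paramsOf d L mT K hL)) c (L ^ s) : Finset _) : Set _) y *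
          ind ((cubeBlocks (MP (paramsOf d L mT K hL)) c (L ^ s) : Finset _) : Set _) y' *
          (2 ^ (d + 1) * (a₁ * (C * Real.exp δ₀) * cr) * Real.exp (-(ρ * tdistT (MP (paramsOf d L mT K hL)) y y')))) := by
  obtain ⟨δ₀, C, hδ₀, hC, HG⟩ := hasMaj_gOp (d := d) hL ha
  refine ⟨δ₀, C, hδ₀, hC, fun s mT K hs hK c T₁ a₁ ρ₁ ρ σ cr hrow ha₁ hρ hρδ hρσ h₁ => ?_⟩
  have hM' : ∀ ν, MP (paramsOf d L s K hL) ν = 2 * L ^ s := fun ν => rfl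
  exact hasMaj_chiCube_comp_liftCubeG_of (L ^ K) (MP_dvd_MP hL hs K) c (L ^ s) hM' (B6UnitTorusCarrier.triangle254_unitTorusGeo L K _) hrow hC.le hδ₀.le ha₁ hρ hρδ hρσ h₁
    (HG s K hK)

end Row

end Summit.QuantumFields.YangMills.BalabanUVNodes.N15.TwoGrid
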